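import Summits.AtomisticToContinuum.Crystallization.Theorems.FrustratedLawDichotomyStrainedPatchHomExteriorRay

/-!
# Strained patch, `(H)` hcp exterior certificate (architecture R3) — E3 STEPS (1)+(2) OF THE §8 RECIPE AS ONE THEOREM: a chain of kernel `curvCheckLJM` box facts along
# a nested box chain gives the piecewise curvature floor `hfloor` of `hver_of_slabParts_pieces` (decomp-a2c hand 2, generation 39; structural #9; DEF-FREE)

RING-LEAF-SPEC rev 6 §8 / critic row 1472 (A), E3 recipe: «(1) `curvLJ_floorM_of_check` on `B_k` at the two ray points `ξ₀ + θ_k(ξ − ξ₀)`, `ξ₀ + θ_{k+1}(ξ − ξ₀)`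
gives the M-floor for the direction `(θ_{k+1} − θ_k)·U(ξ − ξ₀)`; (2) `floor_transport` turns it into `ℓ_k‖U(ξ − ξ₀)‖² ≤ Σ segGd … s` on `(θ_k, θ_{k+1})` with
`ℓ_k := lam_k/SC + (Σ D_ij (UΔ)_i (UΔ)_j)/‖UΔ‖²`».  With the break points of `…HomExteriorRay.exists_exitChain_xiBox` (p854088) this is ONE theorem, independent of the
Bool field layout the successor hand-1's driver will choose:

* §1 the quadratic scaling of the M-form (`mForm_smul`) and the ray-point identities (`U` linear);
* §2 ★★★ `hfloor_chain_of_curvChecks`: common `U`-box (each box's entry part contains `U`), integer-nested ξ-boxes `(cs k, ws k)_{k<m}` with kernel facts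
  `curvCheckLJM (cs k) (ws k) (Lc k) (Ln k) (D k) (lam k) = true` over ONE label list (`(Lc k ++ Ln k).toFinset = B`), `ξ₀` in box `0`, `ξ` in box `m−1`,
  `‖ξ₀‖, ‖ξ‖ ≤ 1/4`, `U(ξ − ξ₀) ≠ 0` ⟹ ∃ break points `θ` (`hθ0/hθm/hmono` of `hver_of_slabParts_pieces`) such that on every piece
  `ℓ k · ‖U(ξ − ξ₀)‖² ≤ Σ_{bb ∈ B} segGd (x⁻⁷ − x⁻¹³) (latPt U hexFrame bb + U(hcpShift + ξ₀)) (U(ξ − ξ₀)) s`, `s ∈ (θ k, θ (k+1))`, with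
  `ℓ k = (lam k/SC·‖UΔ‖² + Σ_{ij} D k i j/SC·(UΔ)_i(UΔ)_j)/‖UΔ‖²` — EXACTLY the `hfloor` hypothesis of `hver_of_slabParts_pieces`, and the `Λ = Σ_k ℓ k (θ(k+1) − θ k)` its
  `hslab` consumes.

What remains of E3 after this (Bool side, successor hand-1's field layout): the label-classification hypotheses `hBin/hR` over the SLAB box, the cell's slope bound `hf₀`,
and the region-minimum inequality making `hslab` vacuous; then `semOKH_of_geomSound` (p854068) per slab and `semOKH_of_cutOK_leaves` for the column.
0 sorry; no definitions; standard axioms.  `--supports stmt-AtomisticToContinuum-27623`.  [folklore chaining]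
-/

noncomputable section

open Set

namespace Summit.AtomisticToContinuum.Crystallization.Theorems.FrustratedLawDichotomyStrainedPatchHomExteriorRay

open scoped BigOperators RealInnerProductSpace
open Literature.Analysis.ValidatedNumerics.Numerics
open Summit.AtomisticToContinuum.Crystallization.Theorems.ChargedEnergyGapNegative (E3)
open Summit.AtomisticToContinuum.Crystallization.Theorems.FrustratedLawDichotomyStrainedPatchHomSplit (latPt hexFrame hcpShift)
open Summit.AtomisticToContinuum.Crystallization.Theorems.FrustratedLawDichotomyStrainedPatchTaylorChord (segGd)
open Summit.AtomisticToContinuum.Crystallization.Theorems.FrustratedLawDichotomyStrainedPatchHomCurvLJ (curvCheckLJM curvLJ_floorM_of_check)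
open Summit.AtomisticToContinuum.Crystallization.Theorems.FrustratedLawDichotomyStrainedPatchHomExteriorTaylor (floor_transport)

/-! ## §1 Scaling of the M-form and the ray-point identities -/

/-- The M-form `lam/SC·‖Δ‖² + Σ D_ij/SC·Δ_iΔ_j` is QUADRATIC: at `t • Δ` it is `t²` times its value at `Δ`. [arithmetic] -/
theorem mForm_smul (lam : ℤ) (D : Fin 3 → Fin 3 → ℤ) (Δ : E3) (t : ℝ) :
    (lam : ℝ) / SC * ‖t • Δ‖ ^ 2 + ∑ i : Fin 3, ∑ j : Fin 3, (D i j : ℝ) / SC * ((t • Δ) i * (t • Δ) j) =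
      t ^ 2 * ((lam : ℝ) / SC * ‖Δ‖ ^ 2 + ∑ i : Fin 3, ∑ j : Fin 3, (D i j : ℝ) / SC * (Δ i * Δ j)) := by
  have hn : ‖t • Δ‖ ^ 2 = t ^ 2 * ‖Δ‖ ^ 2 := by rw [norm_smul, mul_pow, Real.norm_eq_abs, sq_abs]
  have hc : ∀ i : Fin 3, (t • Δ) i = t * Δ i := fun i => by simp
  simp only [hn, hc]
  rw [mul_add, Finset.mul_sum]
  congr 1
  · ring
  · refine Finset.sum_congr rfl fun i _ => ?_
    rw [Finset.mul_sum]
    refine Finset.sum_congr rfl fun j _ => ?_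
    ring

/-- Difference of two ray points: `(ξ₀ + b·Δξ) − (ξ₀ + a·Δξ) = (b − a)·Δξ`. [arithmetic] -/
theorem rayPoint_sub (ξ₀ ξ : E3) (a b : ℝ) : (ξ₀ + b • (ξ - ξ₀)) - (ξ₀ + a • (ξ - ξ₀)) = (b - a) • (ξ - ξ₀) := by
  rw [sub_smul]; abel

/-- The pair base point at a ray point: `latPt U bb + U(hcpShift + (ξ₀ + a·Δξ)) = (latPt U bb + U(hcpShift + ξ₀)) + a·UΔξ`. [arithmetic: `U` linear] -/
theorem basePoint_ray (U : E3 →L[ℝ] E3) (bb : Fin 3 → ℤ) (ξ₀ ξ : E3) (a : ℝ) :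
    latPt U hexFrame bb + U (hcpShift + (ξ₀ + a • (ξ - ξ₀))) = (latPt U hexFrame bb + U (hcpShift + ξ₀)) + a • U (ξ - ξ₀) := by
  simp only [map_add, map_smul]; abel

/-! ## §2 ★★★ The chained curvature floor -/

/-- ★★★ **E3 STEPS (1)+(2): THE PIECEWISE CURVATURE FLOOR FROM A CHAIN OF KERNEL BOX FACTS.**  Entry matrix `U` in every box's entry part; ξ-boxes `(cs k, ws k)`, `k < m`,
nested by integer endpoint containment; ONE label list `B`; kernel facts `curvCheckLJM`; `ξ₀` in box `0`, `ξ` in box `m − 1`, both in the shuffle ball; `U(ξ − ξ₀) ≠ 0`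
⟹ break points `θ` with the `hfloor` hypothesis of `…HomExteriorPieces.hver_of_slabParts_pieces` for
`ℓ k := (lam k/SC·‖UΔ‖² + Σ D k i j/SC·(UΔ)_i(UΔ)_j) / ‖UΔ‖²`, `Δ := ξ − ξ₀`. [folklore chaining: `exists_exitChain_xiBox` + `curvLJ_floorM_of_check` + `floor_transport`] -/
theorem hfloor_chain_of_curvChecks {U : E3 →L[ℝ] E3} (hU : ‖U - 1‖ ≤ 1 / 4) {ξ₀ ξ : E3} (hn₀ : ‖ξ₀‖ ≤ 1 / 4) (hn : ‖ξ‖ ≤ 1 / 4)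
    (m : ℕ) (hm : 0 < m) (cs ws : ℕ → ((Fin 3 × Fin 3) ⊕ Fin 3 → ℤ)) (Lc Ln : ℕ → List (Fin 3 → ℤ)) (D : ℕ → Fin 3 → Fin 3 → ℤ) (lam : ℕ → ℤ)
    (B : Finset (Fin 3 → ℤ)) (hLB : ∀ k, k < m → (Lc k ++ Ln k).toFinset = B) (hnd : ∀ k, k < m → (Lc k ++ Ln k).Nodup)
    (hchk : ∀ k, k < m → curvCheckLJM (cs k) (ws k) (Lc k) (Ln k) (D k) (lam k) = true)
    (hUbox : ∀ k, k < m → ∀ ab : Fin 3 × Fin 3, |(U (EuclideanSpace.single ab.2 (1 : ℝ))) ab.1 - (cs k (Sum.inl ab) : ℝ) / SC| ≤ (ws k (Sum.inl ab) : ℝ) / SC)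
    (hnest : ∀ k, k + 1 < m → ∀ i : Fin 3, cs (k + 1) (Sum.inr i) - ws (k + 1) (Sum.inr i) ≤ cs k (Sum.inr i) - ws k (Sum.inr i) ∧
      cs k (Sum.inr i) + ws k (Sum.inr i) ≤ cs (k + 1) (Sum.inr i) + ws (k + 1) (Sum.inr i))
    (h0 : ∀ i : Fin 3, |ξ₀ i - (cs 0 (Sum.inr i) : ℝ) / SC| ≤ (ws 0 (Sum.inr i) : ℝ) / SC)
    (h1 : ∀ i : Fin 3, |ξ i - (cs (m - 1) (Sum.inr i) : ℝ) / SC| ≤ (ws (m - 1) (Sum.inr i) : ℝ) / SC) (hΔ : U (ξ - ξ₀) ≠ 0) :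
    ∃ θ : ℕ → ℝ, θ 0 = 0 ∧ θ m = 1 ∧ (∀ k, k < m → θ k ≤ θ (k + 1)) ∧ (∀ k, k ≤ m → θ k ∈ Icc (0 : ℝ) 1) ∧
      ∀ k, k < m → ∀ s ∈ Ioo (θ k) (θ (k + 1)),
        ((lam k : ℝ) / SC * ‖U (ξ - ξ₀)‖ ^ 2 + ∑ i : Fin 3, ∑ j : Fin 3, (D k i j : ℝ) / SC * ((U (ξ - ξ₀)) i * (U (ξ - ξ₀)) j)) / ‖U (ξ - ξ₀)‖ ^ 2 *
            ‖U (ξ - ξ₀)‖ ^ 2 ≤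
          ∑ bb ∈ B, segGd (fun x : ℝ => x⁻¹ ^ 7 - x⁻¹ ^ 13) (latPt U hexFrame bb + U (hcpShift + ξ₀)) (U (ξ - ξ₀)) s := by
  obtain ⟨θ, hθ0, hθm, hmono, hrange, hpts⟩ := exists_exitChain_xiBox (ξ₀ := ξ₀) (ξ := ξ) cs ws m hm hnest h0 h1
  refine ⟨θ, hθ0, hθm, hmono, hrange, fun k hk s hs => ?_⟩
  -- the piece is nondegenerate since `s` lies strictly inside it
  have hlt : θ k < θ (k + 1) := hs.1.trans hs.2
  set t : ℝ := θ (k + 1) - θ k with ht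
  have htpos : 0 < t := by rw [ht]; linarith
  have htne : t ≠ 0 := htpos.ne'
  set u : ℝ := (s - θ k) / t with hu
  have hu01 : u ∈ Ioo (0 : ℝ) 1 := by
    constructor
    · rw [hu]; exact div_pos (by linarith [hs.1]) htpos
    · rw [hu, div_lt_one htpos, ht]; linarith [hs.2]
  have hsu : θ k + t * u = s := by rw [hu]; field_simp; ring
  -- the two ray points of the piece
  set P₀ : E3 := ξ₀ + θ k • (ξ - ξ₀) with hP₀
  set P₁ : E3 := ξ₀ + θ (k + 1) • (ξ - ξ₀) with hP₁
  have hP₀n : ‖P₀‖ ≤ 1 / 4 := norm_rayPoint_le hn₀ hn (hrange k hk.le)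
  have hP₁n : ‖P₁‖ ≤ 1 / 4 := norm_rayPoint_le hn₀ hn (hrange (k + 1) (by omega))
  -- step (1): the M-floor on box k along the piece
  have hfl := curvLJ_floorM_of_check (hnd k hk) (hchk k hk) U hU (hUbox k hk) P₀ P₁ (hpts k hk).1 (hpts k hk).2 hP₀n hP₁n hu01
  rw [hLB k hk] at hfl
  -- rewrite direction and base points of the piece
  have hdir : U (P₁ - P₀) = t • U (ξ - ξ₀) := by
    rw [hP₁, hP₀, rayPoint_sub, map_smul]
  have hbase : ∀ bb : Fin 3 → ℤ, latPt U hexFrame bb + U (hcpShift + P₀) = (latPt U hexFrame bb + U (hcpShift + ξ₀)) + θ k • U (ξ - ξ₀) :=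
    fun bb => by rw [hP₀]; exact basePoint_ray U bb ξ₀ ξ (θ k)
  rw [hdir, mForm_smul] at hfl
  simp only [hbase] at hfl
  -- step (2): transport to the original ray
  have hκ : ((lam k : ℝ) / SC * ‖U (ξ - ξ₀)‖ ^ 2 + ∑ i : Fin 3, ∑ j : Fin 3, (D k i j : ℝ) / SC * ((U (ξ - ξ₀)) i * (U (ξ - ξ₀)) j)) /
        ‖U (ξ - ξ₀)‖ ^ 2 * ‖t • U (ξ - ξ₀)‖ ^ 2 =
      t ^ 2 * ((lam k : ℝ) / SC * ‖U (ξ - ξ₀)‖ ^ 2 + ∑ i : Fin 3, ∑ j : Fin 3, (D k i j : ℝ) / SC * ((U (ξ - ξ₀)) i * (U (ξ - ξ₀)) j)) := by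
    have hnz : ‖U (ξ - ξ₀)‖ ^ 2 ≠ 0 := pow_ne_zero 2 (norm_ne_zero_iff.2 hΔ)
    rw [norm_smul, mul_pow, Real.norm_eq_abs, sq_abs]
    field_simp
  have key := floor_transport B (fun x : ℝ => x⁻¹ ^ 7 - x⁻¹ ^ 13) (fun bb => latPt U hexFrame bb + U (hcpShift + ξ₀)) (U (ξ - ξ₀))
    (s₁ := θ k) (t := t) (u := u)
    (κ := ((lam k : ℝ) / SC * ‖U (ξ - ξ₀)‖ ^ 2 + ∑ i : Fin 3, ∑ j : Fin 3, (D k i j : ℝ) / SC * ((U (ξ - ξ₀)) i * (U (ξ - ξ₀)) j)) / ‖U (ξ - ξ₀)‖ ^ 2)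
    htne (by rw [hκ]; exact hfl)
  rw [hsu] at key
  exact key

end Summit.AtomisticToContinuum.Crystallization.Theorems.FrustratedLawDichotomyStrainedPatchHomExteriorRay

end
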